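import Literature.NumberTheory.GaloisCohomology.KatoCohomologyPurity
import Literature.NumberTheory.GaloisCohomology.KatoCohomologyDifferentialForms
import HarnessLib

/-!
# Gersten purity for Kato's `H^{n+1}_p` at points of smooth schemes over perfect fields,
# ON DIFFERENTIAL FORMS (Gros–Suwa 1988, Thm. 1.4)

Companion to `GaloisCohomology/KatoCohomologyPurity` (the same purity statement in the SYMBOLIC
presentation: `Shiho2007_purity`, `GrosSuwa1988_purity`, on `KatoCohomologySymbolic` / `integralSymbols`)
and `GaloisCohomology/KatoCohomologyDifferentialForms` (Kato's group through forms,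
`KatoCohomologyDeRham p K n = Ωⁿ_K ⧸ (dΩⁿ⁻¹_K ⊔ ⟨(a^p − a) · dlog b⟩)`, `formClass p a b`, and the named fact
`BlochKato1986_symbolicPresentation : KatoCohomologySymbolic ≃+ KatoCohomologyDeRham`).

## Why this file

The printed theorem [cite: GrosSuwa1988, Thm. 1.4] (Gersten's conjecture for the logarithmic
Hodge–Witt sheaves on localizations of smooth schemes over a perfect field; statement as quoted in
[cite: Shiho2007, p. 600]) is a statement about `H¹(−, Ωⁿ_log) = Ωⁿ/(dΩⁿ⁻¹ + (F − 1)Ωⁿ)`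
([cite: Shiho2007, Prop. 2.8 and Lemma 3.3]) — i.e. about DIFFERENTIAL FORMS.  Its symbolic form
`GrosSuwa1988_purity` is obtained from the form below by transport along the Bloch–Kato presentation
(`BlochKato1986_symbolicPresentation`, Bloch–Kato Lemma (4.2) — proved in the tree:
`BlochKatoForms.lean`, `BlochKatoFormsSymbol.lean` and the `WildPurityPurityTransfer` stubs of summit
ResolutionOfSingularities).  Recording the de Rham-side statement as its own named fact makes the crux
`WildPurity.PurityTransfer` depend on exactly the part of Gros–Suwa that still needs the (inverse) Cartier
operator and the Cousin-complex argument, and on nothing else.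

## Contents

* `integralFormClasses p n T` — the subgroup of `KatoCohomologyDeRham p K n` generated by the classes of the
  `T`-integral logarithmic forms `a · dlog b₀ ∧ ⋯ ∧ dlog b_{n-1}` (`a ∈ T`, `bᵢ, bᵢ⁻¹ ∈ T`) — the de Rham
  counterpart of `integralSymbols p n T`; for a local ring `T` this is the image of
  `H¹(T, Ωⁿ_log) = Ωⁿ_T/(dΩⁿ⁻¹_T + (F−1)Ωⁿ_T)` (a local ring is additively generated by its units, so `Ωⁿ_T` is
  generated by `T`-integral logarithmic forms — Bloch–Kato Lemma (4.2), surjectivity);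
* `heightOneIntegralFormClasses p n A K = ⋂_{ht P = 1} integralFormClasses p n A_P`, with
  `mem_heightOneIntegralFormClasses_iff`;
* `GrosSuwa1988_purity_deRham` — the NAMED FACT (smooth case, affine-model form, written out elementwise
  so that it is literally the hypothesis of the landed transport theorem `stub_purityTransport`), and its
  restatement `GrosSuwa1988_purity_deRham.heightOneIntegralFormClasses_le` through the definitions above.

## References

* M. Gros, N. Suwa, *La conjecture de Gersten pour les faisceaux de Hodge–Witt logarithmique*, Duke
  Math. J. 57 (1988), 615–628, Thm. 1.4 (paywalled, acq-06474; statement as quoted by Shiho).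
  [GrosSuwa1988]
* A. Shiho, *On logarithmic Hodge–Witt cohomology of regular schemes*, J. Math. Sci. Univ. Tokyo 14
  (2007), 567–635: p. 600 (quotation of Gros–Suwa), Prop. 2.8, Lemma 3.3, Thm. 4.1. [Shiho2007]
* S. Bloch, K. Kato, *p-adic étale cohomology*, Publ. Math. IHÉS 63 (1986), Lemma (4.2). [BlochKato1986]
-/

noncomputable section

namespace Literature.NumberTheory.GaloisCohomology

universe u v w

section Defs

variable (p n : ℕ) {K : Type w} [CommRing K]

/-- INTEGRAL FORM CLASSES: for `T ⊆ K`, the subgroup of `KatoCohomologyDeRham p K n` generated by the classes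
`formClass p a b` of the `T`-integral logarithmic forms `a · dlog b₀ ∧ ⋯ ∧ dlog b_{n-1}` (`a ∈ T`,
`bᵢ, bᵢ⁻¹ ∈ T`) — the de Rham-side counterpart of `KatoCohomologySymbolic.integralSymbols p n T`, its image
under the Bloch–Kato isomorphism. [cite: BlochKato1986, Lemma (4.2)] -/
def integralFormClasses (T : Set K) : AddSubgroup (KatoCohomologyDeRham p K n) :=
  AddSubgroup.closure {x | ∃ (a : K) (b : Fin n → Kˣ), a ∈ T ∧
    (∀ i, (b i : K) ∈ T ∧ (((b i)⁻¹ : Kˣ) : K) ∈ T) ∧ x = formClass p a b}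

variable (A : Type v) (K' : Type w) [CommRing A] [IsDomain A] [Field K'] [Algebra A K'] [IsFractionRing A K']

/-- The classes of `KatoCohomologyDeRham p K n` (`K = Frac A`) generated by `A_P`-integral logarithmic forms for
EVERY height-one prime `P` of `A`: `⋂_{ht P = 1} integralFormClasses p n A_P` — the de Rham-side counterpart of
`heightOneIntegralSymbols p n A K`. [cite: Shiho2007, §4] -/
def heightOneIntegralFormClasses : AddSubgroup (KatoCohomologyDeRham p K' n) :=
  ⨅ P ∈ {P : PrimeSpectrum A | P.asIdeal.height = 1},
    integralFormClasses p n (localizationIn K' P.asIdeal : Set K')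

variable {p n A K'}

/-- Membership in `heightOneIntegralFormClasses`: integral at `A_P` for every height-one prime `P`.
[folklore] -/
theorem mem_heightOneIntegralFormClasses_iff (α : KatoCohomologyDeRham p K' n) :
    α ∈ heightOneIntegralFormClasses p n A K' ↔
      ∀ (P : Ideal A) [P.IsPrime], P.height = 1 →
        α ∈ integralFormClasses p n (localizationIn K' P : Set K') := by
  simp only [heightOneIntegralFormClasses, AddSubgroup.mem_iInf, Set.mem_setOf_eq]
  exact ⟨fun h P _ hP => h ⟨P, ‹P.IsPrime›⟩ hP, fun h P hP => h P.asIdeal hP⟩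

end Defs

/-- NAMED FACT — **Gersten purity for Kato's `H^{n+1}_p` at a point of a smooth scheme over a perfect field,
on differential forms** (Gros–Suwa 1988, Thm. 1.4, a THEOREM: the Gersten (Bloch–Ogus, coniveau) complexes of
the logarithmic Hodge–Witt sheaves `W_mΩ^i_{X,log}` are exact in positive degrees on localizations of schemes `X`
smooth over a perfect field of characteristic `p`; statement as quoted in [cite: Shiho2007, p. 600]).  VENDORED
CONSEQUENCE (`m = 1`, `q = 1`, `i = n`, degrees `0` and `1`; `H¹(T, Ωⁿ_log) = Ωⁿ_T/(dΩⁿ⁻¹_T + (F − 1)Ωⁿ_T)` for the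
local rings `T = B_𝔮, (B_𝔮)_P, K` by [cite: Shiho2007, Prop. 2.8 and Lemma 3.3], and `Ωⁿ_T` generated by
`T`-integral logarithmic forms by [cite: BlochKato1986, Lemma (4.2)]), in the affine-model form consumed by
route WildPurity of summit ResolutionOfSingularities: for `k` perfect of characteristic `p`, `K` a field,
`B ⊆ K` a finitely generated `k`-subalgebra with `Frac B = K` and `𝔮` a prime of `B` with `B_𝔮` regular, **every
class of `KatoCohomologyDeRham p K n = Ωⁿ_K/(dΩⁿ⁻¹_K + ⟨(a^p − a) dlog b⟩)` that is generated by `(B_𝔮)_P`-integral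
logarithmic form classes for every height-one prime `P` of `B_𝔮` is generated by `B_𝔮`-integral logarithmic
form classes** (written out elementwise; equivalently
`heightOneIntegralFormClasses p n B_𝔮 K ≤ integralFormClasses p n B_𝔮`,
`GrosSuwa1988_purity_deRham.heightOneIntegralFormClasses_le`).  Its transport along
`BlochKato1986_symbolicPresentation` is the symbolic `GrosSuwa1988_purity`.  Take it as an explicit hypothesis
`(h : GrosSuwa1988_purity_deRham.{u})`. [cite: GrosSuwa1988, Thm. 1.4] -/
def GrosSuwa1988_purity_deRham : Prop :=
  ∀ (p : ℕ), p.Prime → ∀ (k K : Type u) [Field k] [CharP k p] [PerfectField k] [Field K] [Algebra k K]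
    (B : Subalgebra k K) [IsFractionRing B K], B.FG → ∀ (𝔮 : Ideal B) [𝔮.IsPrime],
    IsRegularLocalRing (Localization.AtPrime 𝔮) → ∀ (n : ℕ) (α : KatoCohomologyDeRham p K n),
      (∀ (P : Ideal (localizationIn K 𝔮)) [P.IsPrime], P.height = 1 →
        α ∈ AddSubgroup.closure {x : KatoCohomologyDeRham p K n | ∃ (a : K) (b : Fin n → Kˣ),
          a ∈ (localizationIn K P : Set K) ∧
          (∀ i, (b i : K) ∈ (localizationIn K P : Set K) ∧
            (((b i)⁻¹ : Kˣ) : K) ∈ (localizationIn K P : Set K)) ∧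
          x = formClass p a b}) →
      α ∈ AddSubgroup.closure {x : KatoCohomologyDeRham p K n | ∃ (a : K) (b : Fin n → Kˣ),
          a ∈ (localizationIn K 𝔮 : Set K) ∧
          (∀ i, (b i : K) ∈ (localizationIn K 𝔮 : Set K) ∧
            (((b i)⁻¹ : Kˣ) : K) ∈ (localizationIn K 𝔮 : Set K)) ∧
          x = formClass p a b}

/-- The named fact through the definitions: under `GrosSuwa1988_purity_deRham`,
`⋂_{ht P = 1} integralFormClasses p n (B_𝔮)_P ≤ integralFormClasses p n B_𝔮` in `KatoCohomologyDeRham p K n` for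
an affine model `B ⊆ K` over a perfect field, regular at `𝔮`. [cite: GrosSuwa1988, Thm. 1.4] -/
theorem GrosSuwa1988_purity_deRham.heightOneIntegralFormClasses_le (h : GrosSuwa1988_purity_deRham.{u})
    {p : ℕ} (hp : p.Prime) (k K : Type u) [Field k] [CharP k p] [PerfectField k] [Field K] [Algebra k K]
    (B : Subalgebra k K) [IsFractionRing B K] (hB : B.FG) (𝔮 : Ideal B) [𝔮.IsPrime]
    (hreg : IsRegularLocalRing (Localization.AtPrime 𝔮)) (n : ℕ) :
    heightOneIntegralFormClasses p n (localizationIn K 𝔮) K ≤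
      integralFormClasses p n (localizationIn K 𝔮 : Set K) :=
  fun α hα => h p hp k K B hB 𝔮 hreg n α
    (fun P _ hP => (mem_heightOneIntegralFormClasses_iff α).1 hα P hP)

end Literature.NumberTheory.GaloisCohomology

end
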